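import Mathlib
import Summits.NavierStokesRegularity.NavierStokesRegularity.Theorems.FilamentSkeletonRssDefectColumnGateLogProfile

/-!
# Route `FilamentSkeletonRss` · crux `TransverseReduction1AG` (stmt-NavierStokesRegularity-27853) · line `defect_column_gate_1AG` —
# MOMENT BOOKKEEPING for the far-field quasimode: product integrals over the section and the vanishing one-dimensional integrals

Helper file (`--supports stmt-NavierStokesRegularity-27853 --as helper`; LEAD of 27853, lane ns-filament-21221-p1 g10): the sectional moment
conditions of `WaistColumnGate1A` for separable vorticities `Σ fᵢ(ξ₀)gᵢ(ξ₁)` reduce (Fubini) to one-dimensional integrals, all of which are integrals of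
derivatives of integrable functions in the owed construction `FarFieldQuasimodes1A` (memo S2A-FALSE-FARFIELD-27853-g10.md §6: `∫F″ = ∫xF″ = 0` for the
compactly supported profile, `∫E″ = ∫yE″ = ∫yE = 0` for the Gaussian).  HONEST FRAMING: elementary real analysis; MODEL rung, negative side; nothing
here bears on Navier–Stokes regularity.
-/

set_option linter.dupNamespace false

noncomputable section

namespace Summit.NavierStokesRegularity.NavierStokesRegularity.Theorems.DefectColumnGate

open scoped Topology ContDiff
open Set Function Filter MeasureTheory WithLp

/-! ## 1. Product integrals over `ℝ² = EuclideanSpace ℝ (Fin 2)` -/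

/-- **Fubini for separable integrands on the section**: `∫_{ℝ²} f(ξ₀)g(ξ₁) dξ = (∫f)(∫g)` (no integrability needed: both sides are junk together). -/
theorem integral_mul_coord_two (f g : ℝ → ℝ) :
    ∫ ξ : EuclideanSpace ℝ (Fin 2), f (ξ 0) * g (ξ 1) = (∫ x, f x) * ∫ y, g y := by
  have htr : ∫ v : Fin 2 → ℝ, f ((toLp 2 v : EuclideanSpace ℝ (Fin 2)) 0) * g ((toLp 2 v : EuclideanSpace ℝ (Fin 2)) 1)
      = ∫ ξ : EuclideanSpace ℝ (Fin 2), f (ξ 0) * g (ξ 1) :=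
    (PiLp.volume_preserving_toLp (Fin 2)).integral_comp (MeasurableEquiv.toLp 2 (Fin 2 → ℝ)).measurableEmbedding
      (fun ξ : EuclideanSpace ℝ (Fin 2) => f (ξ 0) * g (ξ 1))
  rw [← htr]
  have h := integral_fintype_prod_eq_prod (ι := Fin 2) (𝕜 := ℝ) (fun i : Fin 2 => if i = 0 then f else g) (μ := fun _ => volume)
  simp only [Fin.prod_univ_two, Fin.isValue, ↓reduceIte, one_ne_zero] at h
  rw [← volume_pi] at h
  exact h

/-! ## 2. One-dimensional integrals of derivatives -/

/-- `∫ F₂ = 0`: the second profile derivative is the derivative of the (integrable, compactly supported) first. -/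
theorem integral_farProfile_succ {L : ℝ} (hL : 0 < L) (k : ℕ) : ∫ x, farProfile L (k + 1) x = 0 :=
  integral_eq_zero_of_hasDerivAt_of_integrable (hasDerivAt_farProfile hL k)
    ((contDiff_farProfile hL (k + 1) (n := 0)).continuous.integrable_of_hasCompactSupport (hasCompactSupport_farProfile hL (k + 1)))
    ((contDiff_farProfile hL k (n := 0)).continuous.integrable_of_hasCompactSupport (hasCompactSupport_farProfile hL k))

/-- `∫ x·F_{k+2}(x) dx = 0` (`x F_{k+2} = (x F_{k+1} − F_k)′`). -/
theorem integral_mul_farProfile_succ_succ {L : ℝ} (hL : 0 < L) (k : ℕ) : ∫ x, x * farProfile L (k + 2) x = 0 := by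
  have hG : ∀ x, HasDerivAt (fun x => x * farProfile L (k + 1) x - farProfile L k x) (x * farProfile L (k + 2) x) x := fun x => by
    have h1 := ((hasDerivAt_id x).mul (hasDerivAt_farProfile hL (k + 1) x)).sub (hasDerivAt_farProfile hL k x)
    refine h1.congr_deriv ?_
    simp only [id]; ring
  refine integral_eq_zero_of_hasDerivAt_of_integrable hG ?_ ?_
  · exact (continuous_id.mul (contDiff_farProfile hL (k + 2) (n := 0)).continuous).integrable_of_hasCompactSupport
      ((hasCompactSupport_farProfile hL (k + 2)).mul_left)
  · exact ((continuous_id.mul (contDiff_farProfile hL (k + 1) (n := 0)).continuous).sub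
      (contDiff_farProfile hL k (n := 0)).continuous).integrable_of_hasCompactSupport
      (((hasCompactSupport_farProfile hL (k + 1)).mul_left).sub (hasCompactSupport_farProfile hL k))

/-- The Gaussian in Mathlib's form. -/
theorem gaussE_eq (lam : ℝ) : gaussE lam = fun y => Real.exp (-(lam / 2) * y ^ 2) := by
  funext y; rw [gaussE]; ring_nf

/-- `yⁿ·E` is integrable (`lam > 0`). -/
theorem integrable_pow_mul_gaussE {lam : ℝ} (hlam : 0 < lam) (n : ℕ) : Integrable fun y : ℝ => y ^ n * gaussE lam y := by
  have h := integrable_rpow_mul_exp_neg_mul_sq (b := lam / 2) (by positivity) (s := n)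
    (by have : (0:ℝ) ≤ n := n.cast_nonneg; linarith)
  rw [gaussE_eq]
  refine h.congr (Filter.Eventually.of_forall fun y => ?_)
  simp [Real.rpow_natCast]

/-- `E` is integrable. -/
theorem integrable_gaussE {lam : ℝ} (hlam : 0 < lam) : Integrable (gaussE lam) := by
  simpa using integrable_pow_mul_gaussE hlam 0

/-- `p(y)·E` is integrable for `p` a polynomial expression of degree ≤ 3 written out: `(a + b y + c y² + d y³)E`. -/
theorem integrable_poly3_mul_gaussE {lam : ℝ} (hlam : 0 < lam) (a b c d : ℝ) :
    Integrable fun y : ℝ => (a + b * y + c * y ^ 2 + d * y ^ 3) * gaussE lam y := by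
  have h0 := (integrable_pow_mul_gaussE hlam 0).const_mul a
  have h1 := (integrable_pow_mul_gaussE hlam 1).const_mul b
  have h2 := (integrable_pow_mul_gaussE hlam 2).const_mul c
  have h3 := (integrable_pow_mul_gaussE hlam 3).const_mul d
  refine (((h0.add h1).add h2).add h3).congr (Filter.Eventually.of_forall fun y => ?_)
  simp only [Pi.add_apply, pow_zero, one_mul, pow_one]
  ring

/-- `∫ E′ = 0`, i.e. `∫ y·E(y) dy = 0`. -/
theorem integral_mul_gaussE {lam : ℝ} (hlam : 0 < lam) : ∫ y, y * gaussE lam y = 0 := by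
  have hE' : ∀ y, HasDerivAt (gaussE lam) ((0 + (-lam) * y + 0 * y ^ 2 + 0 * y ^ 3) * gaussE lam y) y := fun y => by
    have h := hasDerivAt_gaussE lam y
    refine h.congr_deriv ?_; ring
  have h0 := integral_eq_zero_of_hasDerivAt_of_integrable hE' (integrable_poly3_mul_gaussE hlam _ _ _ _) (integrable_gaussE hlam)
  have e : (fun y => (0 + (-lam) * y + 0 * y ^ 2 + 0 * y ^ 3) * gaussE lam y) = fun y => (-lam) * (y * gaussE lam y) := by
    funext y; ring
  rw [e, integral_const_mul] at h0
  rcases mul_eq_zero.1 h0 with h | h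
  · linarith
  · exact h

/-- `∫ E″ = 0`, i.e. `∫ (lam²y² − lam)·E(y) dy = 0`. -/
theorem integral_gaussE_deriv_two {lam : ℝ} (hlam : 0 < lam) : ∫ y, (lam ^ 2 * y ^ 2 - lam) * gaussE lam y = 0 := by
  -- `E′ = −lam y E`, `(E′)′ = (lam² y² − lam) E`
  have hE'' : ∀ y, HasDerivAt (fun y => (-lam * y) * gaussE lam y) ((lam ^ 2 * y ^ 2 - lam) * gaussE lam y) y := fun y => by
    have h := hasDerivAt_mul_gaussE (lam := lam) ((hasDerivAt_id y).const_mul (-lam))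
    refine h.congr_deriv ?_; simp only [id]; ring
  refine integral_eq_zero_of_hasDerivAt_of_integrable hE'' ?_ ?_
  · have := integrable_poly3_mul_gaussE hlam (-lam) 0 (lam ^ 2) 0
    refine this.congr (Filter.Eventually.of_forall fun y => ?_); ring
  · have := integrable_poly3_mul_gaussE hlam 0 (-lam) 0 0
    refine this.congr (Filter.Eventually.of_forall fun y => ?_); ring

/-- `∫ y·E″(y) dy = 0` (`y E″ = (y E′ − E)′`). -/
theorem integral_mul_gaussE_deriv_two {lam : ℝ} (hlam : 0 < lam) : ∫ y, y * ((lam ^ 2 * y ^ 2 - lam) * gaussE lam y) = 0 := by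
  have hH : ∀ y, HasDerivAt (fun y => (y * (-lam * y) - 1) * gaussE lam y) (y * ((lam ^ 2 * y ^ 2 - lam) * gaussE lam y)) y :=
    fun y => by
      have hp : HasDerivAt (fun y : ℝ => y * (-lam * y) - 1) (1 * (-lam * y) + y * (-lam * 1) - 0) y :=
        ((hasDerivAt_id y).mul ((hasDerivAt_id y).const_mul (-lam))).sub (hasDerivAt_const y 1) |>.congr_deriv (by simp)
      have h := hasDerivAt_mul_gaussE (lam := lam) hp
      refine h.congr_deriv ?_; ring
  refine integral_eq_zero_of_hasDerivAt_of_integrable hH ?_ ?_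
  · have := integrable_poly3_mul_gaussE hlam 0 (-lam) 0 (lam ^ 2)
    refine this.congr (Filter.Eventually.of_forall fun y => ?_); ring
  · have := integrable_poly3_mul_gaussE hlam (-1) 0 (-lam) 0
    refine this.congr (Filter.Eventually.of_forall fun y => ?_); ring

end Summit.NavierStokesRegularity.NavierStokesRegularity.Theorems.DefectColumnGate

end
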